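import Summits.AnomalousDissipation.AnomalousDissipation.Theses.DebrisQuanta
import Literature.Analysis.FluidPDE.LerayHopfRestartTorus

/-!
# Strategist sketch r1 (second opinion) — crux `RecurrentDebris`
(stmt-AnomalousDissipation-2858, route DebrisQuanta)

Typed statements quoted in `STRATEGY-CENSUS-r1.md` (redirect strategist r1, a technique inventory
disjoint from the s1 census: scaling covariance, unforced relaxation, linear (Stokes/heat)
unreachability, time-periodic witnesses, energy reload, exact hits). Nothing here is proposed to
the tree; every `def` is a `Prop` over existing declarations and the file must elaborate
(`lean check` rc 0, no `sorry`). The two `theorem`s are definitional sanity checks.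

Abbreviations (the crux's own inline `let`s, copied verbatim, as in the s1 sketch):
`D α W` = truncated homogeneous cusp `curl[χ(|z|)|z|^{1−α} W(z/|z|)]` centred at `(½,½,½)`;
`Adm α W`; `Bg M b` (calm background); `Good ν f u t₀` (energy inequality from `t₀`);
`tol α c ν = c·ν^{(3−2α)/(2(1−α))}`; `IsDebrisState`.
-/

set_option linter.dupNamespace false

noncomputable section

open Filter Set MeasureTheory Topology

namespace Summit.AnomalousDissipation.AnomalousDissipation.Cruxes.RecurrentDebris.StrategistR1

local notation "𝕋³" => UnitAddTorus (Fin 3)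
local notation "E³" => EuclideanSpace ℝ (Fin 3)

/-! ## The crux's inline predicates (verbatim) -/

/-- The crux's debris profile `D_{α,W}` (verbatim copy of the route's inline `let D`). -/
def D (α : ℝ) (W : E³ → E³) (x : 𝕋³) : E³ :=
  Literature.Analysis.FluidPDE.curl
    (fun z : E³ => (Real.smoothTransition (2 - 8 * ‖z‖) * ‖z‖ ^ (1 - α)) • W (‖z‖⁻¹ • z))
    (Literature.Analysis.FunctionSpaces.Torus.repr x - (!₂[(1:ℝ)/2, 1/2, 1/2] : E³))

/-- Admissible profile potential (verbatim copy of the route's inline `let Adm`). -/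
def Adm (α : ℝ) (W : E³ → E³) : Prop :=
  ContDiff ℝ ((⊤ : ℕ∞) : WithTop ℕ∞) W ∧ ∃ y : E³, y ≠ 0 ∧
    Literature.Analysis.FluidPDE.curl (fun z : E³ => (‖z‖ ^ (1 - α)) • W (‖z‖⁻¹ • z)) y ≠ 0

/-- Calm background of size `M` (verbatim copy of the route's inline `let Bg`). -/
def Bg (M : ℝ) (b : 𝕋³ → E³) : Prop :=
  Literature.Analysis.FunctionSpaces.Torus.IsSmooth b ∧ Literature.Analysis.FunctionSpaces.Torus.IsDivFree b ∧
    ∀ y : E³, ‖Literature.Analysis.FunctionSpaces.Torus.lift b y‖ ≤ M ∧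
      ‖fderiv ℝ (Literature.Analysis.FunctionSpaces.Torus.lift b) y‖ ≤ M

/-- Energy inequality from `t₀` (verbatim copy of the route's inline `let Good`). -/
def Good (ν : ℝ) (f : 𝕋³ → E³) (u : ℝ → 𝕋³ → E³) (t₀ : ℝ) : Prop :=
  ∀ t : ℝ, t₀ ≤ t →
    Literature.Analysis.FunctionSpaces.Torus.kineticEnergy (u t) +
        ν * (∫⁻ s in Set.Ioo t₀ t, Literature.Analysis.FunctionSpaces.Torus.eGradNormSq (u s)).toReal ≤
      Literature.Analysis.FunctionSpaces.Torus.kineticEnergy (u t₀) + ∫ s in t₀..t, ∫ x, inner ℝ (f x) (u s x)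

/-- The debris tolerance `c·ν^{(3−2α)/(2(1−α))}` as an extended real. -/
def tol (α c ν : ℝ) : ENNReal := ENNReal.ofReal (c * ν ^ ((3 - 2 * α) / (2 * (1 - α))))

/-- `v` is a debris state at viscosity `ν` (within tolerance of `b + D(· − a)`). -/
def IsDebrisState (α : ℝ) (W : E³ → E³) (M c ν : ℝ) (v : 𝕋³ → E³) : Prop :=
  ∃ (a : 𝕋³) (b : 𝕋³ → E³), Bg M b ∧
    MeasureTheory.eLpNorm (fun x => v x - b x - D α W (x - a)) 2 MeasureTheory.volume ≤ tol α c ν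

/-! ## The crux body with its witnesses exposed -/

/-- `DebrisFamily α W f M c L E ν u₀ u`: the body of `RecurrentDebris` after its ten existential
quantifiers, verbatim (so that `RecurrentDebris ↔ ∃ …, DebrisFamily …` holds by `Iff.rfl`,
`recurrentDebris_iff`). Exposing `f` lets the census state the unforced (`f = 0`), exact
(`c = 0`) and periodic specialisations as one-line variants. -/
def DebrisFamily (α : ℝ) (W : E³ → E³) (f : 𝕋³ → E³) (M c L E : ℝ) (ν : ℕ → ℝ)
    (u₀ : ℕ → 𝕋³ → E³) (u : ℕ → ℝ → 𝕋³ → E³) : Prop :=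
  2/3 < α ∧ α < 1 ∧ Adm α W ∧ Literature.Analysis.FunctionSpaces.Torus.IsSmooth f ∧
    Literature.Analysis.FunctionSpaces.Torus.IsDivFree f ∧ Literature.Analysis.FunctionSpaces.Torus.HasZeroMean f ∧ 0 < L ∧
    (∀ j, 0 < ν j) ∧ Filter.Tendsto ν Filter.atTop (nhds 0) ∧
    (∀ j, Literature.Analysis.FluidPDE.Torus.IsGlobalLerayHopf (ν j) (fun _ => f) (u₀ j) (u j)) ∧
    (∀ j (t : ℝ), 0 ≤ t → Literature.Analysis.FunctionSpaces.Torus.kineticEnergy (u j t) ≤ E) ∧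
    ∀ j (T : ℝ), 0 ≤ T → ∃ t ∈ Set.Icc T (T + L), ∃ (a : 𝕋³) (b : 𝕋³ → E³),
      Good (ν j) f (u j) t ∧ Bg M b ∧
      MeasureTheory.eLpNorm (fun x => u j t x - b x - D α W (x - a)) 2 MeasureTheory.volume ≤
        ENNReal.ofReal (c * (ν j) ^ ((3 - 2 * α) / (2 * (1 - α))))

/-- Sanity (definitional): the crux is literally `∃ witnesses, DebrisFamily witnesses`. -/
theorem recurrentDebris_iff :
    Theses.DebrisQuanta.RecurrentDebris ↔
      ∃ (α : ℝ) (W : E³ → E³) (f : 𝕋³ → E³) (M c L E : ℝ) (ν : ℕ → ℝ) (u₀ : ℕ → 𝕋³ → E³)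
        (u : ℕ → ℝ → 𝕋³ → E³), DebrisFamily α W f M c L E ν u₀ u :=
  Iff.rfl

/-! ## STRENGTHEN — typed S⁺ candidates of this inventory -/

/-- **S_per `PeriodicDebrisWitness`** (time-periodic Leray–Hopf witnesses: the "UPO / spontaneous
periodic orbit" form of recurrence). For each `j` the solution is `P j`-periodic on `t ≥ 0` with
`0 < P j ≤ L` and makes one good debris visit per period; periodicity transports the visit to every
window of length `L`. Strictly STRONGER than the crux and with no leverage: existence of
large-amplitude periodic orbits of steadily forced 3-D Navier–Stokes at small `ν` is open even
without the cusp requirement (computer-assisted proofs reach one moderate `ν` at a time). -/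
def PeriodicDebrisWitness : Prop :=
  ∃ (α : ℝ) (W : E³ → E³) (f : 𝕋³ → E³) (M c L E : ℝ) (ν : ℕ → ℝ) (u₀ : ℕ → 𝕋³ → E³)
    (u : ℕ → ℝ → 𝕋³ → E³) (P : ℕ → ℝ),
    2/3 < α ∧ α < 1 ∧ Adm α W ∧ Literature.Analysis.FunctionSpaces.Torus.IsSmooth f ∧
    Literature.Analysis.FunctionSpaces.Torus.IsDivFree f ∧ Literature.Analysis.FunctionSpaces.Torus.HasZeroMean f ∧ 0 < L ∧
    (∀ j, 0 < ν j) ∧ Filter.Tendsto ν Filter.atTop (nhds 0) ∧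
    (∀ j, Literature.Analysis.FluidPDE.Torus.IsGlobalLerayHopf (ν j) (fun _ => f) (u₀ j) (u j)) ∧
    (∀ j (t : ℝ), 0 ≤ t → Literature.Analysis.FunctionSpaces.Torus.kineticEnergy (u j t) ≤ E) ∧
    (∀ j, 0 < P j ∧ P j ≤ L ∧ ∀ t : ℝ, 0 ≤ t → u j (t + P j) = u j t) ∧
    ∀ j, ∃ t ∈ Set.Icc 0 (P j), Good (ν j) f (u j) t ∧ IsDebrisState α W M c (ν j) (u j t)

/-- **S_exact `ExactDebrisWitness`** (the `c = 0` slice: the visit state IS `b + D(·−a)` a.e.).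
Since `b + D(·−a) ∉ H¹` while Leray–Hopf slices are `H¹` for a.e. `t`, every visit time is a
singular time of a fixed-`ν > 0` Leray–Hopf solution: finite-time blow-up of forced 3-D
Navier–Stokes with a subcritical (`|y|^{−α}`, `α < 1`) terminal profile, recurring. Strictly
stronger than the crux (`exactDebrisWitness_implies`) and harder than the regularity problem. -/
def ExactDebrisWitness : Prop :=
  ∃ (α : ℝ) (W : E³ → E³) (f : 𝕋³ → E³) (M L E : ℝ) (ν : ℕ → ℝ) (u₀ : ℕ → 𝕋³ → E³)
    (u : ℕ → ℝ → 𝕋³ → E³), DebrisFamily α W f M 0 L E ν u₀ u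

/-- `S_exact ⇒ crux` (take `c = 0`). -/
theorem exactDebrisWitness_implies (h : ExactDebrisWitness) : Theses.DebrisQuanta.RecurrentDebris := by
  obtain ⟨α, W, f, M, L, E, ν, u₀, u, hfam⟩ := h
  exact recurrentDebris_iff.mpr ⟨α, W, f, M, 0, L, E, ν, u₀, u, hfam⟩

/-! ## TRANSFER — the scaling-covariance sibling dies on the torus with a fixed force -/

/-- **T_scal `SelfSimilarForceVanishes`** (provable now; kills the transfer of the forward
self-similar / discretely-self-similar machinery). The parabolic rescaling
`u ↦ a·u(n·x, a n·t)` maps viscosity-`ν` solutions on `T³` to viscosity-`νa/n` solutions with force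
`a²n·f(n·x)` (`n ∈ ℕ` to preserve 1-periodicity). A FIXED nonzero force would need
`f = A·f(n·)` for some `n ≥ 2`; on the Fourier side `f̂(k) = A·f̂(k/n)` if `n ∣ k` and `0`
otherwise, so by infinite descent `f̂(k) = 0` for `k ≠ 0`, and `f̂(0) = 0` by zero mean: `f = 0`.
Hence no `ν_j`-family of witnesses is generated from one solution by symmetry, and the unforced
case is excluded separately (`NoUnforcedWitness`). -/
def SelfSimilarForceVanishes : Prop :=
  ∀ (f : 𝕋³ → E³) (n : ℕ) (A : ℝ), Literature.Analysis.FunctionSpaces.Torus.IsSmooth f →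
    Literature.Analysis.FunctionSpaces.Torus.HasZeroMean f → 2 ≤ n →
    (∀ x : 𝕋³, f x = A • f (n • x)) → f = 0

/-! ## NEGATION — typed obstructions of this inventory (all provable now; none refutes the crux) -/

/-- **N0 `NoUnforcedWitness`** (provable now; "any proof must use `f ≠ 0`"). For unforced global
Leray–Hopf solutions on `T³` the mean `ū` is conserved (test the weak form against constant
fields) and the fluctuation energy decays, `KE(u(t) − ū) ≤ KE(u₀ − ū)·e^{−8π²νt}` (energy
inequality from `0` and from a.e. `s`, Poincaré); so for `t ≥ T_j(ν_j, E, δ)` every slice is within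
`δ` in `L²` of a constant field. But `dist_{L²}(C − b, D(·−a) + B) ≥ δ₀(α,W,M) > 0` uniformly over
constants `C`, calm `b` and points `a`, because `{g : ‖∇g‖₂ ≤ M'}` is `L²`-closed (Fatou on the
Fourier side) and `D ∉ H¹` for `α > 1/2` (the `(−α)`-homogeneous tip has `|∇D| ≳ |y|^{−1−α}` on a
cone). With `c ν_j^{p} + δ < δ₀` there is no visit in `[T_j, T_j + L]`. Stated without the `Good`
conjunct (stronger) and for `1/2 < α < 3/2`. -/
def NoUnforcedWitness : Prop :=
  ∀ (α : ℝ) (W : E³ → E³) (M c L E : ℝ) (ν : ℕ → ℝ) (u₀ : ℕ → 𝕋³ → E³) (u : ℕ → ℝ → 𝕋³ → E³),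
    1/2 < α → α < 3/2 → Adm α W → (∀ j, 0 < ν j) → Filter.Tendsto ν Filter.atTop (nhds 0) →
    (∀ j, Literature.Analysis.FluidPDE.Torus.IsGlobalLerayHopf (ν j) (fun _ => 0) (u₀ j) (u j)) →
    (∀ j (t : ℝ), 0 ≤ t → Literature.Analysis.FunctionSpaces.Torus.kineticEnergy (u j t) ≤ E) →
    ∃ j, ∃ T : ℝ, 0 ≤ T ∧ ∀ t ∈ Set.Icc T (T + L), ¬ IsDebrisState α W M c (ν j) (u j t)

/-- N0 specialises the crux: no `DebrisFamily` with `f = 0`. -/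
theorem no_unforced_family (h : NoUnforcedWitness) :
    ¬ ∃ (α : ℝ) (W : E³ → E³) (M c L E : ℝ) (ν : ℕ → ℝ) (u₀ : ℕ → 𝕋³ → E³)
        (u : ℕ → ℝ → 𝕋³ → E³), DebrisFamily α W 0 M c L E ν u₀ u := by
  rintro ⟨α, W, M, c, L, E, ν, u₀, u, hα, hα', hAdm, -, -, -, -, hν, hν0, hLH, hE, hvis⟩
  obtain ⟨j, T, hT, hno⟩ :=
    h α W M c L E ν u₀ u (by linarith) (by linarith) hAdm hν hν0 hLH hE
  obtain ⟨t, ht, a, b, -, hb, hd⟩ := hvis j T hT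
  exact hno t ht ⟨a, b, hb, hd⟩

/-- Dyadic Fourier shell mass `∑_{K² ≤ |k|² < 4K²} ‖v̂(k)‖²` of a real vector field on `T³`
(coefficients of the complexified field, as in `Torus.eGradNormSq`). -/
def shellMass (v : 𝕋³ → E³) (K : ℝ) : ENNReal :=
  ∑' k : Fin 3 → ℤ,
    Set.indicator {k : Fin 3 → ℤ | K ^ 2 ≤ Literature.Analysis.FunctionSpaces.Torus.freqNormSq k ∧
        Literature.Analysis.FunctionSpaces.Torus.freqNormSq k < 4 * K ^ 2}
      (fun k => ‖UnitAddTorus.mFourierCoeff (Literature.Analysis.FunctionSpaces.EuclideanSpace.complexify ∘ v) k‖ₑ ^ 2) k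

/-- **N_shell `DebrisShellFloor`** (provable now; the kinematic parent of the s1 enstrophy floor
N1a, of N0's `D ∉ H¹` and of N3). Every field within `ε` in `L²` of some `b + D(·−a)` (`b` calm of
size `M`) carries Fourier shell mass `≥ c₀K^{−(3−2α)} − 2ε²` (halved) at EVERY dyadic shell
`K ≥ K₀(α,W,M)`: the `(−α)`-homogeneous tip gives `shellMass D K ≍ K^{−(3−2α)}` for all large `K`
(lattice Riemann sum of `|Û|²`, `Û` homogeneous of degree `α−3`, smooth off `0`, `≢ 0` by `Adm`),
the calm part contributes `≤ M²/(4π²K²) ≪ K^{−(3−2α)}` because `α > 1/2`, and Parseval moves the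
`ε`-perturbation (`‖x+y‖² ≤ 2‖x‖² + 2‖y‖²` shellwise). -/
def DebrisShellFloor : Prop :=
  ∀ (α : ℝ) (W : E³ → E³) (M : ℝ), 1/2 < α → α < 3/2 → Adm α W →
    ∃ c₀ K₀ : ℝ, 0 < c₀ ∧ 0 < K₀ ∧ ∀ K : ℝ, K₀ ≤ K →
      ∀ (v : 𝕋³ → E³) (a : 𝕋³) (b : 𝕋³ → E³) (ε : ℝ), MeasureTheory.MemLp v 2 MeasureTheory.volume →
        Bg M b → 0 ≤ ε →
        MeasureTheory.eLpNorm (fun x => v x - b x - D α W (x - a)) 2 MeasureTheory.volume ≤ ENNReal.ofReal ε →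
        ENNReal.ofReal (c₀ * K ^ (-(3 - 2 * α))) ≤ 2 * shellMass v K + ENNReal.ofReal (2 * ε ^ 2)

/-- **N3 `StokesUnreachability`** (provable now from `DebrisShellFloor`; "any proof must use the
nonlinearity at the arrest wavenumber `λ⁻¹ = ν^{−1/(1−α)}` inside every window"). Let `v` be the
LINEAR heat/Stokes flow at viscosity `ν` and time `t` from ANY `L²` datum `v₀` of energy `≤ E`
under the steady smooth force `f` (on divergence-free data this is the Stokes flow; stated through
its Fourier coefficients `v̂(k) = e^{−4π²νt|k|²} v̂₀(k) + (∫₀ᵗ e^{−4π²ν(t−s)|k|²}ds) f̂(k)`). Then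
`v` is NOT a debris state as soon as `A ν^{(1+α)/(1−α)} |log ν| ≤ t ≤ 1`: at the shell
`K² = B|log ν|/(4π²νt)` the datum part is damped to `ν^{B}√(2E)`, the force part is
`O_N(K^{−N})`, while a debris state needs shell mass `≍ K^{−(3−2α)} ≥ (4π²A/B)^{(3−2α)/2} ν^{2p}`,
beating the tolerance `c²ν^{2p}` for `A` large. So each visit requires the quadratic term to
rebuild shell mass `≳ ν^{p}` at `|k| ≍ λ⁻¹` (up to logarithms) within time `L`, afresh in every
window: the visit is a fully nonlinear event at scales `≪` Kolmogorov's `ν^{−3/4}`. -/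
def StokesUnreachability : Prop :=
  ∀ (α : ℝ) (W : E³ → E³) (f : 𝕋³ → E³) (M c E : ℝ), 2/3 < α → α < 1 → Adm α W →
    Literature.Analysis.FunctionSpaces.Torus.IsSmooth f →
    ∃ A ν₁ : ℝ, 0 < A ∧ 0 < ν₁ ∧ ν₁ < 1 ∧ ∀ (ν t : ℝ) (v₀ v : 𝕋³ → E³), 0 < ν → ν ≤ ν₁ →
      MeasureTheory.MemLp v₀ 2 MeasureTheory.volume →
      Literature.Analysis.FunctionSpaces.Torus.kineticEnergy v₀ ≤ E →
      MeasureTheory.MemLp v 2 MeasureTheory.volume →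
      A * ν ^ ((1 + α) / (1 - α)) * |Real.log ν| ≤ t → t ≤ 1 →
      (∀ k : Fin 3 → ℤ,
        UnitAddTorus.mFourierCoeff (Literature.Analysis.FunctionSpaces.EuclideanSpace.complexify ∘ v) k =
          ((Real.exp (-(4 * Real.pi ^ 2 * ν * t * Literature.Analysis.FunctionSpaces.Torus.freqNormSq k)) : ℝ) : ℂ) •
              UnitAddTorus.mFourierCoeff (Literature.Analysis.FunctionSpaces.EuclideanSpace.complexify ∘ v₀) k +
            ((∫ s in (0:ℝ)..t,
                Real.exp (-(4 * Real.pi ^ 2 * ν * (t - s) * Literature.Analysis.FunctionSpaces.Torus.freqNormSq k)) : ℝ) : ℂ) •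
              UnitAddTorus.mFourierCoeff (Literature.Analysis.FunctionSpaces.EuclideanSpace.complexify ∘ f) k) →
      ¬ IsDebrisState α W M c ν v

/-! ## DECOMPOSITION — the one provable half of an energy-level split -/

/-- **R `EnergyReload`** (provable now; the "reload" half of the split
`Reload(e₀) ∣ Ignition(e₀)`). A global Leray–Hopf solution driven by a nonzero steady smooth
divergence-free force cannot stay quiescent: in every window of length `L₀(f)` after time `0` its
kinetic energy reaches `e₀(f) > 0`, uniformly in `0 < ν ≤ 1` and in the datum. Proof: test the
weak form with `ψ = η(t) f(x)`; while `KE(u) < e₀`,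
`d/dt ⟨u, f⟩ = −⟨u ⊗ u, ∇f⟩ + ν⟨u, Δf⟩ + ‖f‖₂² ≥ ‖f‖₂²/2`, yet `|⟨u, f⟩| ≤ ‖f‖₂ (2e₀)^{1/2}`.
The complementary "ignition" half (from EVERY state of energy in `[e₀, E]` a debris visit within
time `L`) is a `∀`-statement over states, stronger than the existential crux and not credible;
this `∃/∀` mismatch is why no state-space split of the crux separates (census §Decomposition). -/
def EnergyReload : Prop :=
  ∀ f : 𝕋³ → E³, Literature.Analysis.FunctionSpaces.Torus.IsSmooth f →
    Literature.Analysis.FunctionSpaces.Torus.IsDivFree f → f ≠ 0 →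
    ∃ e₀ L₀ : ℝ, 0 < e₀ ∧ 0 < L₀ ∧ ∀ (ν : ℝ) (u₀ : 𝕋³ → E³) (u : ℝ → 𝕋³ → E³), 0 < ν → ν ≤ 1 →
      Literature.Analysis.FluidPDE.Torus.IsGlobalLerayHopf ν (fun _ => f) u₀ u →
      ∀ T : ℝ, 0 < T → ∃ t ∈ Set.Icc T (T + L₀), e₀ ≤ Literature.Analysis.FunctionSpaces.Torus.kineticEnergy (u t)

/-! ## Sanity: the inline predicates agree with the route's (definitional unfolding) -/

example (α : ℝ) (W : E³ → E³) (M c ν : ℝ) (v : 𝕋³ → E³) :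
    IsDebrisState α W M c ν v ↔ ∃ (a : 𝕋³) (b : 𝕋³ → E³), Bg M b ∧
      MeasureTheory.eLpNorm (fun x => v x - b x - D α W (x - a)) 2 MeasureTheory.volume ≤
        ENNReal.ofReal (c * ν ^ ((3 - 2 * α) / (2 * (1 - α)))) := Iff.rfl

end Summit.AnomalousDissipation.AnomalousDissipation.Cruxes.RecurrentDebris.StrategistR1

end
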